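import Mathlib
import Literature.NumberTheory.Sieve.ParityBatemanHorn
import Literature.NumberTheory.Sieve.BatemanHornProofs
import Summits.Parity.BatemanHorn.Theses.IsogenyRedei
import Summits.Parity.BatemanHorn.Theorems.IsogenyRedeiLambdaToCountCurves
import Summits.Parity.BatemanHorn.Theorems.IsogenyRedeiLambdaToCountPowerValues
import Summits.Parity.BatemanHorn.Theorems.IsogenyRedeiLambdaToCountSandwich
import HarnessLib

/-!
# `LambdaToCount` (item stmt-Parity-0874): from `Λ`-weighted prime tuples to the Bateman–Horn count

We prove the route statement `Summit.Parity.BatemanHorn.Theses.IsogenyRedei.LambdaToCount`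
(shared verbatim by the routes PolynomialMobius, CubicRoots, TwoCMLines, CyclotomicTower,
SelmerPencil, IsogenyRedei, CrossedSalie, GaussianFractions of `Parity/BatemanHorn`):
for a Bateman–Horn system `f₁, …, f_k ∈ ℤ[X]` and `C > 0` with `HasBatemanHornConst f C`,

  `Σ_{n ≤ x} ∏ᵢ Λ(fᵢ(n)) ~ C x  ⟹  #{n ≤ x : all fᵢ(n) prime} ~ C/(∏ deg fᵢ) · x/(log x)^k`,

i.e. `BatemanHornAsymptotic f`.

Proof. `∏ᵢ Λ(fᵢ(n))` vanishes unless every `fᵢ(n)` is a prime power; on prime tuples it equals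
`w(n) = ∏ᵢ log fᵢ(n) ~ (∏ degᵢ)(log n)^k` (`fᵢ(n) ~ aᵢ n^{dᵢ}`), and the tuples with some
`fᵢ(n) = p^a`, `a ≥ 2`, number `≪ x^{7/8}` (file `…PowerValues`: Bombieri–Pila on the
absolutely irreducible curves `Y^a = fᵢ(X)`, file `…Curves`), so they contribute `o(x)`.
The sandwich/partial-summation step is file `…Sandwich`. Finally `polyPrimeCount` differs from
the count over `1 ≤ n ≤ x` by the single term `n = 0`.
-/

open Finset Filter Asymptotics Polynomial ArithmeticFunction
open scoped Classical Topology

namespace Summit.Parity.BatemanHorn.LambdaToCount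

open Literature.NumberTheory.Sieve

/-! ### `Λ`-products versus `log`-products -/

/-- `0 ≤ ∏ᵢ Λ(mᵢ)`. -/
theorem prod_vonMangoldt_nonneg {ι : Type*} [Fintype ι] (m : ι → ℕ) : 0 ≤ ∏ i, Λ (m i) :=
  prod_nonneg fun _ _ => vonMangoldt_nonneg

/-- `∏ᵢ Λ(mᵢ) ≤ ∏ᵢ log mᵢ`. -/
theorem prod_vonMangoldt_le_prod_log {ι : Type*} [Fintype ι] (m : ι → ℕ) :
    ∏ i, Λ (m i) ≤ ∏ i, Real.log (m i) :=
  prod_le_prod (fun _ _ => vonMangoldt_nonneg) fun _ _ => vonMangoldt_le_log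

/-- On prime tuples `∏ᵢ Λ(mᵢ) = ∏ᵢ log mᵢ`. -/
theorem prod_vonMangoldt_eq_prod_log {ι : Type*} [Fintype ι] (m : ι → ℕ) (h : ∀ i, (m i).Prime) :
    ∏ i, Λ (m i) = ∏ i, Real.log (m i) :=
  prod_congr rfl fun i _ => vonMangoldt_apply_prime (h i)

/-- If `∏ᵢ Λ(mᵢ) ≠ 0` but not all `mᵢ` are prime, some `mᵢ` is a proper prime power. -/
theorem exists_eq_prime_pow {ι : Type*} [Fintype ι] (m : ι → ℕ) (h0 : ∏ i, Λ (m i) ≠ 0)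
    (h : ¬∀ i, (m i).Prime) : ∃ i, ∃ p a : ℕ, p.Prime ∧ 2 ≤ a ∧ m i = p ^ a := by
  push Not at h
  obtain ⟨i, hi⟩ := h
  have hne : Λ (m i) ≠ 0 := (prod_ne_zero_iff.mp h0) i (mem_univ i)
  rw [vonMangoldt_ne_zero_iff] at hne
  obtain ⟨p, a, hp, ha, hpa⟩ := (isPrimePow_nat_iff _).mp hne
  refine ⟨i, p, a, hp, ?_, hpa.symm⟩
  by_contra hlt
  have : a = 1 := by omega
  subst this
  rw [pow_one] at hpa
  exact hi (hpa ▸ hp)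

/-! ### The weights `w(n) = ∏ᵢ log fᵢ(n) ~ (∏ᵢ deg fᵢ) (log n)^k` -/

/-- For `g ∈ ℤ[X]` of degree `d ≥ 1` with positive leading coefficient,
`log g(n) ~ d · log n` as `n → ∞` (here `g(n)` is read through `Int.toNat`, as in
`polyPrimeCount`). -/
theorem isEquivalent_log_eval {g : ℤ[X]} (hd : 0 < g.natDegree) (hlc : 0 < g.leadingCoeff) :
    (fun n : ℕ => Real.log (((g.eval (n : ℤ)).toNat : ℕ) : ℝ)) ~[atTop]
      fun n : ℕ => (g.natDegree : ℝ) * Real.log n := by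
  set P : ℝ[X] := g.map (Int.castRingHom ℝ) with hP
  have hinj : Function.Injective (Int.castRingHom ℝ) := Int.cast_injective
  have hPdeg : P.natDegree = g.natDegree := natDegree_map_eq_of_injective hinj _
  have hPlc : P.leadingCoeff = (g.leadingCoeff : ℝ) := leadingCoeff_map_of_injective hinj _
  have hPlc0 : 0 < P.leadingCoeff := by
    rw [hPlc]
    exact_mod_cast hlc
  have heval : ∀ n : ℕ, P.eval (n : ℝ) = ((g.eval (n : ℤ) : ℤ) : ℝ) := fun n => by
    rw [hP, ← Int.cast_natCast (R := ℝ) n, eval_intCast_map (Int.castRingHom ℝ) g (n : ℤ)]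
    simp
  have h1 : (fun n : ℕ => ((g.eval (n : ℤ) : ℤ) : ℝ)) ~[atTop]
      fun n : ℕ => P.leadingCoeff * (n : ℝ) ^ g.natDegree := by
    have := (Polynomial.isEquivalent_atTop_lead P).comp_tendsto tendsto_natCast_atTop_atTop
    rw [hPdeg] at this
    exact this.congr_left (Eventually.of_forall fun n => heval n)
  have h2 : Tendsto (fun n : ℕ => P.leadingCoeff * (n : ℝ) ^ g.natDegree) atTop atTop :=
    (tendsto_const_mul_pow_atTop hd.ne' hPlc0).comp tendsto_natCast_atTop_atTop
  have h3 : (fun n : ℕ => (((g.eval (n : ℤ)).toNat : ℕ) : ℝ)) ~[atTop]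
      fun n : ℕ => P.leadingCoeff * (n : ℝ) ^ g.natDegree := by
    refine h1.congr_left ?_
    have hev : ∀ᶠ n : ℕ in atTop, (0 : ℝ) ≤ ((g.eval (n : ℤ) : ℤ) : ℝ) :=
      (h1.symm.tendsto_atTop h2).eventually_ge_atTop 0
    filter_upwards [hev] with n hn
    have hn' : 0 ≤ g.eval (n : ℤ) := by exact_mod_cast hn
    have : (((g.eval (n : ℤ)).toNat : ℕ) : ℤ) = g.eval (n : ℤ) := Int.toNat_of_nonneg hn'
    rw [← this]
    norm_cast
  have h4 := h3.log h2
  have h5 : (fun n : ℕ => Real.log (P.leadingCoeff * (n : ℝ) ^ g.natDegree)) ~[atTop]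
      fun n : ℕ => (g.natDegree : ℝ) * Real.log n := by
    have hlogn : Tendsto (fun n : ℕ => (g.natDegree : ℝ) * Real.log n) atTop atTop :=
      Tendsto.const_mul_atTop (by exact_mod_cast hd)
        (Real.tendsto_log_atTop.comp tendsto_natCast_atTop_atTop)
    refine IsLittleO.isEquivalent ?_
    have hconst : (fun _ : ℕ => Real.log P.leadingCoeff) =o[atTop]
        fun n : ℕ => (g.natDegree : ℝ) * Real.log n :=
      isLittleO_const_left.mpr (Or.inr (tendsto_norm_atTop_atTop.comp hlogn))
    refine hconst.congr' ?_ EventuallyEq.rfl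
    filter_upwards [eventually_gt_atTop 0] with n hn
    have hn' : (0 : ℝ) < n := by exact_mod_cast hn
    simp only [Pi.sub_apply]
    rw [Real.log_mul hPlc0.ne' (by positivity), Real.log_pow]
    ring
  exact h4.trans h5

/-- For a Bateman–Horn system, `w(n) = ∏ᵢ log fᵢ(n) ~ (∏ᵢ deg fᵢ) · (log n)^k`. -/
theorem isEquivalent_prod_log {k : ℕ} {f : Fin k → ℤ[X]} (hf : IsBatemanHornSystem f) :
    (fun n : ℕ => ∏ i, Real.log ((((f i).eval (n : ℤ)).toNat : ℕ) : ℝ)) ~[atTop]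
      fun n : ℕ => (∏ i, ((f i).natDegree : ℝ)) * Real.log n ^ k := by
  have h := IsEquivalent.finsetProd (s := (univ : Finset (Fin k))) (l := atTop)
    (f := fun i (n : ℕ) => Real.log ((((f i).eval (n : ℤ)).toNat : ℕ) : ℝ))
    (g := fun i (n : ℕ) => ((f i).natDegree : ℝ) * Real.log n)
    (fun i _ => isEquivalent_log_eval (hf.natDegree_pos i) (hf.leadingCoeff_pos i))
  refine h.congr_right (Eventually.of_forall fun n => ?_)
  simp only
  rw [prod_mul_distrib, prod_const, card_univ, Fintype.card_fin]

/-! ### The exceptional set of the system -/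

/-- `#{1 ≤ n ≤ x : some fᵢ(n) is a proper prime power} ≤ K · x^{7/8}`. -/
theorem card_filter_bad_le {k : ℕ} {f : Fin k → ℤ[X]} (hf : IsBatemanHornSystem f) :
    ∃ K : ℝ, ∀ x : ℕ, 1 ≤ x →
      (#((Icc 1 x).filter fun n : ℕ => ∃ i, ∃ p a : ℕ, p.Prime ∧ 2 ≤ a ∧
          ((f i).eval (n : ℤ)).toNat = p ^ a) : ℝ) ≤ K * (x : ℝ) ^ (7 / 8 : ℝ) := by
  have h : ∀ i, ∃ K : ℝ, ∀ x : ℕ, 1 ≤ x →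
      (#((Icc 1 x).filter fun n : ℕ => ∃ p a : ℕ, p.Prime ∧ 2 ≤ a ∧
          ((f i).eval (n : ℤ)).toNat = p ^ a) : ℝ) ≤ K * (x : ℝ) ^ (7 / 8 : ℝ) :=
    fun i => card_filter_properPrimePow_le (hf.irreducible i) (hf.natDegree_pos i)
  choose K hK using h
  refine ⟨∑ i, K i, fun x hx => ?_⟩
  have hsub : ((Icc 1 x).filter fun n : ℕ => ∃ i, ∃ p a : ℕ, p.Prime ∧ 2 ≤ a ∧
        ((f i).eval (n : ℤ)).toNat = p ^ a) ⊆
      (univ : Finset (Fin k)).biUnion fun i =>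
        (Icc 1 x).filter fun n : ℕ => ∃ p a : ℕ, p.Prime ∧ 2 ≤ a ∧
          ((f i).eval (n : ℤ)).toNat = p ^ a := by
    intro n hn
    rw [mem_filter] at hn
    obtain ⟨hn, i, hi⟩ := hn
    exact mem_biUnion.mpr ⟨i, mem_univ i, mem_filter.mpr ⟨hn, hi⟩⟩
  calc (#((Icc 1 x).filter fun n : ℕ => ∃ i, ∃ p a : ℕ, p.Prime ∧ 2 ≤ a ∧
          ((f i).eval (n : ℤ)).toNat = p ^ a) : ℝ)
      ≤ ∑ i, (#((Icc 1 x).filter fun n : ℕ => ∃ p a : ℕ, p.Prime ∧ 2 ≤ a ∧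
          ((f i).eval (n : ℤ)).toNat = p ^ a) : ℝ) := by
        exact_mod_cast (card_le_card hsub).trans card_biUnion_le
    _ ≤ ∑ i, K i * (x : ℝ) ^ (7 / 8 : ℝ) := sum_le_sum fun i _ => hK i x hx
    _ = (∑ i, K i) * (x : ℝ) ^ (7 / 8 : ℝ) := by rw [sum_mul]

/-! ### The main theorem -/

/-- `x / (log x)^k → ∞` along `ℕ`, in the normalised form `C/D · x/(log x)^k`. -/
theorem tendsto_norm_main_term {C D : ℝ} (hC : 0 < C) (hD : 0 < D) (k : ℕ) :
    Tendsto (fun x : ℕ => ‖C / D * (x : ℝ) / Real.log x ^ k‖) atTop atTop := by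
  have hlo : (fun x : ℕ => Real.log x ^ k) =o[atTop] fun x : ℕ => (x : ℝ) := by
    have := isLittleO_log_pow_mul_rpow (show (0 : ℝ) < 1 by norm_num) k
    refine this.congr' ?_ ?_
    · filter_upwards with x
      rw [Real.rpow_zero, mul_one]
    · filter_upwards with x
      exact Real.rpow_one _
  have hdiv : Tendsto (fun x : ℕ => Real.log x ^ k / (x : ℝ)) atTop (𝓝 0) := hlo.tendsto_div_nhds_zero
  have hpos : ∀ᶠ x : ℕ in atTop, Real.log x ^ k / (x : ℝ) ∈ Set.Ioi (0 : ℝ) := by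
    filter_upwards [eventually_ge_atTop 2] with x hx
    have : 0 < Real.log x := Real.log_pos (by exact_mod_cast hx)
    exact div_pos (pow_pos this k) (by positivity)
  have hinv : Tendsto (fun x : ℕ => (Real.log x ^ k / (x : ℝ))⁻¹) atTop atTop :=
    tendsto_inv_nhdsGT_zero.comp (tendsto_nhdsWithin_iff.mpr ⟨hdiv, hpos⟩)
  have hmain : Tendsto (fun x : ℕ => C / D * (x : ℝ) / Real.log x ^ k) atTop atTop := by
    refine (Tendsto.const_mul_atTop (div_pos hC hD) hinv).congr fun x => ?_
    rw [inv_div]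
    ring
  exact tendsto_norm_atTop_atTop.comp hmain

/-- **`LambdaToCount` (stmt-Parity-0874).** If `Σ_{n ≤ x} ∏ᵢ Λ(fᵢ(n)) ~ C x` for a
Bateman–Horn system `f` with `HasBatemanHornConst f C`, `C > 0`, then `BatemanHornAsymptotic f`:
`#{n ≤ x : all fᵢ(n) prime} ~ C/(∏ deg fᵢ) · x/(log x)^k`. -/
theorem lambdaToCount_proof : Summit.Parity.BatemanHorn.Theses.IsogenyRedei.LambdaToCount := by
  intro k f hf C hC hBH hS
  refine ⟨C, hBH, ?_⟩
  set D : ℝ := ∏ i, ((f i).natDegree : ℝ) with hD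
  have hD0 : 0 < D := prod_pos fun i _ => by exact_mod_cast hf.natDegree_pos i
  obtain ⟨K, hK⟩ := card_filter_bad_le hf
  -- the data of the sandwich
  set good : ℕ → Prop := fun n => ∀ i, 0 < (f i).eval (n : ℤ) ∧ (((f i).eval (n : ℤ)).toNat).Prime
    with hgood_def
  set bad : ℕ → Prop := fun n => ∃ i, ∃ p a : ℕ, p.Prime ∧ 2 ≤ a ∧
    ((f i).eval (n : ℤ)).toNat = p ^ a with hbad_def
  have hbad : ∀ n : ℕ, ∏ i, Λ (((f i).eval (n : ℤ)).toNat) ≠ 0 → ¬good n → bad n := by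
    intro n h0 hng
    refine exists_eq_prime_pow _ h0 fun hall => hng fun i => ⟨?_, hall i⟩
    exact Int.lt_toNat.mp (hall i).pos
  have hQ := isEquivalent_card_good (k := k) (K := K) hC hD0
    (fun n => ∏ i, Real.log ((((f i).eval (n : ℤ)).toNat : ℕ) : ℝ))
    (fun n => ∏ i, Λ (((f i).eval (n : ℤ)).toNat)) good bad
    (fun n => prod_vonMangoldt_nonneg _) (fun n => prod_vonMangoldt_le_prod_log _)
    (fun n hn => prod_vonMangoldt_eq_prod_log _ fun i => (hn i).2) hbad hK
    (isEquivalent_prod_log hf) hS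
  -- `polyPrimeCount` versus the count over `1 ≤ n ≤ x`
  have hPQ : ∀ x : ℕ, (#((Icc 1 x).filter good) : ℝ) ≤ polyPrimeCount f x ∧
      (polyPrimeCount f x : ℝ) ≤ #((Icc 1 x).filter good) + 1 := by
    intro x
    have hP : polyPrimeCount f x = #((range (x + 1)).filter good) := by
      unfold polyPrimeCount
      convert rfl
    have h1 : #((Icc 1 x).filter good) ≤ #((range (x + 1)).filter good) := by
      refine card_le_card fun n hn => ?_
      rw [mem_filter, mem_Icc] at hn
      exact mem_filter.mpr ⟨mem_range.mpr (by omega), hn.2⟩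
    have h2 : #((range (x + 1)).filter good) ≤ #((Icc 1 x).filter good) + 1 := by
      refine (card_le_card fun n hn => ?_).trans (card_insert_le 0 _)
      rw [mem_filter, mem_range] at hn
      rw [mem_insert, mem_filter, mem_Icc]
      rcases Nat.eq_zero_or_pos n with h | h
      · exact Or.inl h
      · exact Or.inr ⟨⟨h, by omega⟩, hn.2⟩
    rw [hP]
    exact ⟨by exact_mod_cast h1, by exact_mod_cast h2⟩
  -- conclusion
  have hg : Tendsto (fun x : ℕ => ‖C / D * (x : ℝ) / Real.log x ^ k‖) atTop atTop :=
    tendsto_norm_main_term hC hD0 k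
  have hQ' : (fun x : ℕ => (#((Icc 1 x).filter good) : ℝ)) ~[atTop]
      fun x : ℕ => C / D * (x : ℝ) / Real.log x ^ k := by
    refine hQ.congr_right (Eventually.of_forall fun x => ?_)
    ring
  have hr : (fun x : ℕ => (polyPrimeCount f x : ℝ) - #((Icc 1 x).filter good)) =o[atTop]
      fun x : ℕ => C / D * (x : ℝ) / Real.log x ^ k := by
    refine IsBigO.trans_isLittleO ?_ ((isLittleO_one_left_iff ℝ).mpr hg)
    refine IsBigO.of_bound 1 (Eventually.of_forall fun x => ?_)
    obtain ⟨h1, h2⟩ := hPQ x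
    rw [Real.norm_eq_abs, norm_one, mul_one, abs_le]
    constructor <;> linarith
  simp only [Fintype.card_fin]
  refine IsLittleO.isEquivalent ?_
  refine (hQ'.isLittleO.add hr).congr' (Eventually.of_forall fun x => ?_) EventuallyEq.rfl
  simp only [Pi.sub_apply]
  ring

end Summit.Parity.BatemanHorn.LambdaToCount
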